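import Literature.NumberTheory.Transcendental.PeriodConjecture
import Literature.NumberTheory.Transcendental.KZCalculusProofs
import Literature.Computability.Complexity.ComputableRealProofs
import Literature.Computability.Complexity.NonElementaryReal
import Literature.Computability.Complexity.UniformDiagonal
import Literature.NumberTheory.Transcendental.SemialgebraicVolumeComputable
import HarnessLib

/-!
# `PeriodConjecture.lean`: discharges and reductions (proof file)

Sibling proof file of `Literature/NumberTheory/Transcendental/PeriodConjecture.lean`.

* **Discharged** (D-0014), from the proofs of the KZ calculus in `KZCalculus.lean` /
  `KZCalculusProofs.lean`:
  * `kz_equivalent_value_eq_holds` — representations connected by the moves have the same value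
    (soundness of the calculus, `KZ.Equivalent.value_eq_holds`);
  * `isRealPeriod_iff_exists_kzIntegralRep_holds` — real periods are exactly the values of integral
    representations with `ℚ`-semialgebraic data (`KZ.isRealPeriod_iff_exists_integralRep_holds`,
    "rational ⇔ algebraic integrands", KZ §1.1, via Tarski–Seidenberg).
* **Reduced** (Yoshinaga's theorem, periods.S08): the computability statements
  `isComputableReal_of_isRealPeriod` and `isComputableComplex_of_isPeriod` follow from the single
  printed theorem `isElementaryReal_of_isRealPeriod` [Yoshinaga 2008, Thm. 1.1] and the discharged
  fact `IsElementaryReal.isComputableReal_holds` (Tent–Ziegler 2010); the theorems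
  `isComputableReal_of_isRealPeriod_of_isElementaryReal`,
  `isComputableComplex_of_isPeriod_of_isComputableReal`,
  `isComputableComplex_of_isPeriod_of_isElementaryReal` record these implications. Likewise the
  corollary `exists_isComputableReal_not_isRealPeriod` (a computable non-period) follows from
  `isElementaryReal_of_isRealPeriod` and the *proved* diagonalisation
  `Literature.Computability.Complexity.exists_isComputableReal_not_isElementaryReal`
  [Yoshinaga 2008, §2.3, Prop. 17 of the arXiv text] (file
  `Literature/Computability/Complexity/NonElementaryReal.lean`); the theorem
  `exists_isComputableReal_not_isRealPeriod_of_isElementaryReal_of_isRealPeriod` records this, so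
  that only `isElementaryReal_of_isRealPeriod` (the main theorem: Thm. 18, §3.1, in the numbering of the
  held arXiv text, cited as Thm. 1.1 in the statement file; its printed
  proof uses Hironaka's rectilinearisation, Tarski's quantifier elimination and Minkowski-content
  bounds, §§3.2–3.6) remains as named-fact debt of that file: each `…_holds` of periods.S08 is a
  one-line consequence of `isElementaryReal_of_isRealPeriod_holds` once that lands.
* **The interface of the diagonal argument** (periods.S08, same corollary): what the proof of
  `exists_isComputableReal_not_isRealPeriod` uses of Thm. 18 is only that the real periods are
  *uniformly named* — some computable double sequence of rationals `G : ℕ → ℕ → ℚ` has, for every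
  real period `x`, a row `i` with `|x - G i n| ≤ 1/(n+1)` for all `n`. The theorems
  `exists_isComputableReal_not_isRealPeriod_of_uniformNames` (and `…_of_uniformFastNames` for
  `2⁻ⁿ`-names) derive the corollary from any such `G` by the general effective diagonal of
  `Literature/Computability/Complexity/UniformDiagonal.lean`, and
  `exists_uniformNames_of_isElementaryReal` shows that Thm. 18 supplies one (the rows of the
  universal function `primrecEnum` for primitive recursive functions, elementary ⊆ primitive
  recursive). So `exists_isComputableReal_not_isRealPeriod_holds` also follows from any *uniform
  computability* theorem for periods in a coding of their integral representations (cf. the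
  hypothesis `UniformlyComputable` of
  `Literature/Barriers/KontsevichZagierPeriods/PeriodEqualityDecidability.lean`), without
  elementarity or a rate of convergence.
* **Reduced to Yoshinaga's Lemma 24 as printed** (periods.S08, computability statements):
  Yoshinaga's Lemma 24 says that the ring of periods is *generated* by the volumes `vol(D)` of
  bounded (basic open) semialgebraic sets. Volumes of bounded `ℚ`-semialgebraic sets are computable
  reals (`SemialgVolume.isComputableReal_volume`, `SemialgebraicVolumeComputable.lean`: the
  computable form of §§3.3–3.6 — Tarski–Seidenberg makes the cube counts primitive recursive, the
  null frontier makes the Riemann sums converge) and the computable reals form a subring of `ℝ`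
  (`Literature.Computability.Complexity.subringClosure_subset_computableReals`), so the *subring*
  generated by those volumes consists of computable reals; the theorems
  `isComputableReal_of_isRealPeriod_of_mem_subringClosure_volumes` and
  `isComputableComplex_of_isPeriod_of_mem_subringClosure_volumes` derive the two computability
  facts from the ring-generation hypothesis (the weakest of the bounded-reduction hypotheses used in
  the tree; cf. `…_of_boundedReduction`, `…_of_boundedRepresentation`,
  `isElementaryReal_of_isRealPeriod_of_mem_closure_volumes`). That hypothesis — resolution of
  singularities for the naive `IsRealPeriod` — is NOT vendored as a named fact.
* **Not dischargeable**: `KZKernelConjecture` / `KZPeriodConjecture'` are forms of the *open*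
  Kontsevich–Zagier period conjecture [Kontsevich–Zagier 2001, §1.2, Conjecture 1;
  Huber–Müller-Stach 2017, Conj. 13.2.1]; see `KZKernelConjectureForms.lean` for their equivalence.

## References

* M. Kontsevich, D. Zagier, *Periods*, in: Mathematics Unlimited — 2001 and Beyond, Springer
  (2001), 771–808, §§1.1–1.2.
* M. Yoshinaga, *Periods and elementary real numbers*, arXiv:0805.0349 (2008), main theorem
  (§3.1, Thm. 18 in the numbering of the held arXiv text; cited as Thm. 1.1 in the statement file)
  and the sentence following it; §2.3, Prop. 17; §3.2, Lemma 24.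
* K. Tent, M. Ziegler, *Computable functions of reals*, Münster J. Math. 3 (2010), §§1–2.
-/

noncomputable section

namespace Literature.NumberTheory.Transcendental

/-! ### periods.S01, definitional side: discharges -/

/-- **Discharge of `kz_equivalent_value_eq`** (soundness of the KZ calculus): representations
connected by the moves have the same value — `KZ.Equivalent.value_eq_holds`.
[Kontsevich–Zagier 2001, §1.2] [cite: KontsevichZagier2001, §1.2] -/
theorem kz_equivalent_value_eq_holds : kz_equivalent_value_eq := by
  intro n m r r' h
  exact KZ.Equivalent.value_eq_holds h

/-- **Discharge of `isRealPeriod_iff_exists_kzIntegralRep`**: real periods are exactly the values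
of integral representations of the KZ calculus — `KZ.isRealPeriod_iff_exists_integralRep_holds`
("rational ⇔ algebraic integrands", proved in `KZCalculusProofs.lean` via Tarski–Seidenberg).
[Kontsevich–Zagier 2001, §1.1, remark after the Definition]
[cite: KontsevichZagier2001, §1.1 remark after the Definition] -/
theorem isRealPeriod_iff_exists_kzIntegralRep_holds : isRealPeriod_iff_exists_kzIntegralRep := by
  intro x
  exact KZ.isRealPeriod_iff_exists_integralRep_holds

/-! ### periods.S08, Yoshinaga's theorem: reductions to the elementary-real statement -/

/-- **Computable from elementary.** Yoshinaga's computability statement for real periods follows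
from his elementarity theorem (`isElementaryReal_of_isRealPeriod`, [Yoshinaga 2008, Thm. 1.1]) and
"elementary reals are computable" (`IsElementaryReal.isComputableReal_holds`, Tent–Ziegler 2010).
[cite: Yoshinaga2008, arXiv:0805.0349 Thm. 1.1] -/
theorem isComputableReal_of_isRealPeriod_of_isElementaryReal
    (h : isElementaryReal_of_isRealPeriod) : isComputableReal_of_isRealPeriod := by
  intro x hx
  exact Literature.Computability.Complexity.IsElementaryReal.isComputableReal_holds (h hx)

/-- **Complex form from the real form.** A period `z` has real and imaginary parts real periods
(`IsPeriod`), and `z` is a computable complex number iff both parts are computable reals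
(`IsComputableComplex`); so the complex computability statement is the real one applied twice.
[cite: Yoshinaga2008, arXiv:0805.0349 Thm. 1.1 complex form] -/
theorem isComputableComplex_of_isPeriod_of_isComputableReal
    (h : isComputableReal_of_isRealPeriod) : isComputableComplex_of_isPeriod := by
  intro z hz
  exact ⟨h hz.1, h hz.2⟩

/-- **Complex computability from elementarity.** Every Kontsevich–Zagier period is a computable
complex number, granted Yoshinaga's elementarity theorem for real periods.
[cite: Yoshinaga2008, arXiv:0805.0349 Thm. 1.1 complex form] -/
theorem isComputableComplex_of_isPeriod_of_isElementaryReal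
    (h : isElementaryReal_of_isRealPeriod) : isComputableComplex_of_isPeriod :=
  isComputableComplex_of_isPeriod_of_isComputableReal
    (isComputableReal_of_isRealPeriod_of_isElementaryReal h)

/-- **A computable non-period from elementarity** (periods.S08). Yoshinaga 2008,
arXiv:0805.0349, §3.1, the sentence after the main theorem (Thm. 18 in the numbering of the held
arXiv text; the statement file cites it as Thm. 1.1): "So the real number `α` constructed above is not a period", `α`
being the computable, non-elementary real number of §2.3, Prop. 17. Formally: if every real period
is an elementary real (`isElementaryReal_of_isRealPeriod`), then there is a computable real number
which is not a real period (`exists_isComputableReal_not_isRealPeriod`) — namely any computable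
non-elementary real, which exists by the proved theorem
`Literature.Computability.Complexity.exists_isComputableReal_not_isElementaryReal` (Prop. 17).
[cite: Yoshinaga2008, arXiv:0805.0349 §3.1 Thm. 18 and §2.3 Prop. 17] -/
theorem exists_isComputableReal_not_isRealPeriod_of_isElementaryReal_of_isRealPeriod
    (h : isElementaryReal_of_isRealPeriod) : exists_isComputableReal_not_isRealPeriod := by
  obtain ⟨x, hx, hne⟩ :=
    Literature.Computability.Complexity.exists_isComputableReal_not_isElementaryReal
  unfold exists_isComputableReal_not_isRealPeriod
  exact ⟨x, hx, fun hp => hne (h hp)⟩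

/-! ### periods.S08: the interface of the diagonal argument — uniform names of periods -/

/-- **Uniform names ⇒ a computable non-period.** If a computable double sequence of rationals
`G : ℕ → ℕ → ℚ` names every real period — each real period `x` has a row `i` with
`|x - G i n| ≤ 1/(n+1)` for all `n` — then there is a computable real number which is not a real
period: the diagonal real of `G`
(`Literature.Computability.Complexity.exists_isComputableReal_forall_not_name`, the effective
Cantor diagonal). This is all that the proof of Yoshinaga's corollary uses of his Thm. 18
(`exists_uniformNames_of_isElementaryReal` below); neither elementarity nor a rate of convergence
of the names is needed. [folklore] -/
theorem exists_isComputableReal_not_isRealPeriod_of_uniformNames (G : ℕ → ℕ → ℚ)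
    (hG : Computable₂ G)
    (hcover : ∀ x : ℝ, IsRealPeriod x → ∃ i : ℕ, ∀ n : ℕ, |x - G i n| ≤ 1 / ((n : ℝ) + 1)) :
    exists_isComputableReal_not_isRealPeriod := by
  obtain ⟨x, hx, hne⟩ :=
    Literature.Computability.Complexity.exists_isComputableReal_forall_not_name G hG
  unfold exists_isComputableReal_not_isRealPeriod
  refine ⟨x, hx, fun hp => ?_⟩
  obtain ⟨i, hi⟩ := hcover x hp
  exact hne i hi

/-- **Uniform fast names ⇒ a computable non-period**: the same with fast (`2⁻ⁿ`) Cauchy names,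
the format of `IsComputableReal` and of dyadic codings
(`Literature.Computability.Complexity.exists_isComputableReal_forall_not_fastName`). [folklore] -/
theorem exists_isComputableReal_not_isRealPeriod_of_uniformFastNames (G : ℕ → ℕ → ℚ)
    (hG : Computable₂ G)
    (hcover : ∀ x : ℝ, IsRealPeriod x → ∃ i : ℕ, ∀ n : ℕ, |x - G i n| ≤ (1 / 2 : ℝ) ^ n) :
    exists_isComputableReal_not_isRealPeriod := by
  obtain ⟨x, hx, hne⟩ :=
    Literature.Computability.Complexity.exists_isComputableReal_forall_not_fastName G hG
  unfold exists_isComputableReal_not_isRealPeriod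
  refine ⟨x, hx, fun hp => ?_⟩
  obtain ⟨i, hi⟩ := hcover x hp
  exact hne i hi

/-- **Thm. 18 gives uniform names.** If every real period is an elementary real
(`isElementaryReal_of_isRealPeriod`; Yoshinaga 2008, arXiv:0805.0349, Thm. 18 of the arXiv text,
Thm. 1.1 in the statement file), then the computable double sequence
`Literature.Computability.Complexity.primrecTripleSeq` — rows
`n ↦ (u ⟨0,n⟩ - u ⟨1,n⟩)/(u ⟨2,n⟩ + 1)` of the universal function `u = primrecEnum e` for the
primitive recursive functions — names every real period: the elementary witnesses `a b c` of a
period are primitive recursive (`ElementaryRec.primrec_holds`) and merge into one row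
(`exists_primrecEnum_eq_triple`). This is Yoshinaga's enumeration `β_e ⊇ P` of the elementary
reals (§2.3, Def. 15) over Mathlib's codes, enlarged to the primitive recursive reals.
[cite: Yoshinaga2008, arXiv:0805.0349 §3.1 Thm. 18 and §2.3 Def. 15] -/
theorem exists_uniformNames_of_isElementaryReal (h : isElementaryReal_of_isRealPeriod) :
    ∃ G : ℕ → ℕ → ℚ, Computable₂ G ∧
      ∀ x : ℝ, IsRealPeriod x → ∃ i : ℕ, ∀ n : ℕ, |x - G i n| ≤ 1 / ((n : ℝ) + 1) := by
  refine ⟨Literature.Computability.Complexity.primrecTripleSeq,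
    Literature.Computability.Complexity.computable_primrecTripleSeq, fun x hx => ?_⟩
  obtain ⟨a, b, c, ha, hb, hc, happrox⟩ := h hx
  obtain ⟨e, he⟩ := Literature.Computability.Complexity.exists_primrecEnum_eq_triple
    (Literature.Computability.Complexity.ElementaryRec.primrec_holds ha)
    (Literature.Computability.Complexity.ElementaryRec.primrec_holds hb)
    (Literature.Computability.Complexity.ElementaryRec.primrec_holds hc)
  refine ⟨e, fun n => ?_⟩
  rw [Literature.Computability.Complexity.primrecTripleSeq_cast, (he n).1, (he n).2.1, (he n).2.2]
  exact happrox n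

/-- **The corollary through the interface.** Thm. 18 ⇒ uniform names ⇒ a computable non-period:
the same implication as
`exists_isComputableReal_not_isRealPeriod_of_isElementaryReal_of_isRealPeriod`, obtained by
composing `exists_uniformNames_of_isElementaryReal` with
`exists_isComputableReal_not_isRealPeriod_of_uniformNames` (recorded as an `example`, not a second
name for the same statement). [cite: Yoshinaga2008, arXiv:0805.0349 §3.1 Thm. 18] -/
example (h : isElementaryReal_of_isRealPeriod) : exists_isComputableReal_not_isRealPeriod := by
  obtain ⟨G, hG, hcover⟩ := exists_uniformNames_of_isElementaryReal h
  exact exists_isComputableReal_not_isRealPeriod_of_uniformNames G hG hcover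


/-! ### periods.S08: the computability statements from Yoshinaga's Lemma 24 (ring generation) -/

open MeasureTheory Literature.Computability.Complexity in
/-- **Real periods are computable, granted Yoshinaga's Lemma 24 as printed.** Lemma 24 of
Yoshinaga 2008 (arXiv:0805.0349, §3.2): "Periods `P` is generated by
`{vol(D) | D ⊂ ℝᵏ is bounded basic open semi-algebraic set}`" (proved there from Hironaka's
rectilinearization, Prop. 22, and the Belkale–Brosnan description of periods, Prop. 23). If every
real period lies in the subring of `ℝ` generated by the volumes of bounded `ℚ`-semialgebraic sets
(hypothesis, not asserted), then every real period is a computable real: such volumes are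
computable reals (`SemialgVolume.isComputableReal_volume`) and the computable reals form a subring
(`subringClosure_subset_computableReals`). [cite: Yoshinaga2008, Theorem 18 with Lemma 24] -/
theorem isComputableReal_of_isRealPeriod_of_mem_subringClosure_volumes
    (h24 : ∀ x : ℝ, IsRealPeriod x →
      x ∈ Subring.closure {v : ℝ | ∃ (m : ℕ) (D : Set (Fin m → ℝ)),
        Literature.ModelTheory.ExponentialFields.IsSemialgebraic ℚ D ∧ Bornology.IsBounded D ∧
        v = (volume D).toReal}) :
    isComputableReal_of_isRealPeriod := by
  intro x hx
  refine subringClosure_subset_computableReals (fun v hv => ?_) (h24 x hx)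
  obtain ⟨m, D, hD, hb, rfl⟩ := hv
  exact SemialgVolume.isComputableReal_volume hD hb

open MeasureTheory in
/-- **Periods are computable complex numbers, granted Yoshinaga's Lemma 24 as printed** (complex
form of the previous theorem, through `isComputableComplex_of_isPeriod_of_isComputableReal`).
[cite: Yoshinaga2008, Theorem 18 with Lemma 24, complex form] -/
theorem isComputableComplex_of_isPeriod_of_mem_subringClosure_volumes
    (h24 : ∀ x : ℝ, IsRealPeriod x →
      x ∈ Subring.closure {v : ℝ | ∃ (m : ℕ) (D : Set (Fin m → ℝ)),
        Literature.ModelTheory.ExponentialFields.IsSemialgebraic ℚ D ∧ Bornology.IsBounded D ∧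
        v = (volume D).toReal}) :
    isComputableComplex_of_isPeriod :=
  isComputableComplex_of_isPeriod_of_isComputableReal
    (isComputableReal_of_isRealPeriod_of_mem_subringClosure_volumes h24)

end Literature.NumberTheory.Transcendental
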